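import Mathlib

/-!
# Leg actions on coordinate 3-tensors and the central submodule

Support file 1/2 for item `JunkNecessary` of route StrassenDefect
(stmt-MatrixMultiplication-4079): the junk-free self-reduction `m² ⊙ ⟨N,N,N⟩ ⊵ ⟨mN,mN,mN⟩` is
impossible. The proof (in `…StrassenDefectJunkNecessaryCentral` and
`…StrassenDefectJunkNecessary`) is elementary and GIT-free; this file sets up the calculus.

* `lift₁ P t`, `lift₂ Q t`, `lift₃ Z t` — the action of a (possibly rectangular) matrix on one
  leg of a coordinate tensor `t : ι → κ → μ → R`, e.g. `(P ·₁ t) a b c = ∑ x, P a x * t x b c`;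
  functoriality (`lift₁_lift₁`), commutation of different legs (`lift₁_lift₂`, …), linearity,
  compatibility with entrywise ring homomorphisms (`map_lift₁`) and with reindexing
  (`lift₁_submatrix`).
* `central t` — the **central submodule** of `t`: triples `(X, Y, Z)` of square matrices with
  `X ·₁ t = Z ·₃ t` and `Y ·₂ t = Z ·₃ t`. For the structure tensor of a unital algebra `𝒜`
  these are exactly the triples `(L_u, L_u, L_u)` with `u` in the centre `Z(𝒜)`; the dimension
  of `central` is the invariant that separates `⟨mN,mN,mN⟩` (centre `ℂ`) from `m² ⊙ ⟨N,N,N⟩`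
  (centre `ℂ^{m²}`).

Everything is over a commutative ring; no topology.
-/

-- single-conjunct summit: the `Summit.<S>.<P>` prefix repeats `MatrixMultiplication` by design (D-0017)
set_option linter.dupNamespace false

noncomputable section

namespace Summit.MatrixMultiplication.MatrixMultiplication.Theorems

open scoped BigOperators

namespace Central

variable {R : Type*} [CommRing R]
variable {ι κ μ ι' κ' μ' ι'' : Type*}

/-! ## Leg actions -/

/-- Action of a (possibly rectangular) matrix on the first leg of a 3-tensor:
`(P ·₁ t) a b c = ∑ x, P a x * t x b c`. [folklore] -/
def lift₁ [Fintype ι] (P : Matrix ι' ι R) (t : ι → κ → μ → R) : ι' → κ → μ → R :=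
  fun a b c => ∑ x, P a x * t x b c

/-- Action of a matrix on the second leg: `(Q ·₂ t) a b c = ∑ y, Q b y * t a y c`. [folklore] -/
def lift₂ [Fintype κ] (Q : Matrix κ' κ R) (t : ι → κ → μ → R) : ι → κ' → μ → R :=
  fun a b c => ∑ y, Q b y * t a y c

/-- Action of a matrix on the third leg: `(Z ·₃ t) a b c = ∑ z, Z c z * t a b z`. [folklore] -/
def lift₃ [Fintype μ] (Z : Matrix μ' μ R) (t : ι → κ → μ → R) : ι → κ → μ' → R :=
  fun a b c => ∑ z, Z c z * t a b z

/-- Unfolding `lift₁`. [folklore] -/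
theorem lift₁_apply [Fintype ι] (P : Matrix ι' ι R) (t : ι → κ → μ → R) (a : ι') (b : κ)
    (c : μ) : lift₁ P t a b c = ∑ x, P a x * t x b c := rfl

/-- Unfolding `lift₂`. [folklore] -/
theorem lift₂_apply [Fintype κ] (Q : Matrix κ' κ R) (t : ι → κ → μ → R) (a : ι) (b : κ')
    (c : μ) : lift₂ Q t a b c = ∑ y, Q b y * t a y c := rfl

/-- Unfolding `lift₃`. [folklore] -/
theorem lift₃_apply [Fintype μ] (Z : Matrix μ' μ R) (t : ι → κ → μ → R) (a : ι) (b : κ)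
    (c : μ') : lift₃ Z t a b c = ∑ z, Z c z * t a b z := rfl

/-- Functoriality on the first leg: `P ·₁ (P' ·₁ t) = (P P') ·₁ t`. [folklore] -/
theorem lift₁_lift₁ [Fintype ι] [Fintype ι'] (P : Matrix ι'' ι' R) (P' : Matrix ι' ι R)
    (t : ι → κ → μ → R) : lift₁ P (lift₁ P' t) = lift₁ (P * P') t := by
  funext a b c
  simp only [lift₁, Matrix.mul_apply, Finset.mul_sum, Finset.sum_mul]
  exact Finset.sum_comm.trans
    (Finset.sum_congr rfl fun _ _ => Finset.sum_congr rfl fun _ _ => by ring)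

/-- Functoriality on the second leg. [folklore] -/
theorem lift₂_lift₂ [Fintype κ] [Fintype κ'] (Q : Matrix ι'' κ' R) (Q' : Matrix κ' κ R)
    (t : ι → κ → μ → R) : lift₂ Q (lift₂ Q' t) = lift₂ (Q * Q') t := by
  funext a b c
  simp only [lift₂, Matrix.mul_apply, Finset.mul_sum, Finset.sum_mul]
  exact Finset.sum_comm.trans
    (Finset.sum_congr rfl fun _ _ => Finset.sum_congr rfl fun _ _ => by ring)

/-- Functoriality on the third leg. [folklore] -/
theorem lift₃_lift₃ [Fintype μ] [Fintype μ'] (Z : Matrix ι'' μ' R) (Z' : Matrix μ' μ R)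
    (t : ι → κ → μ → R) : lift₃ Z (lift₃ Z' t) = lift₃ (Z * Z') t := by
  funext a b c
  simp only [lift₃, Matrix.mul_apply, Finset.mul_sum, Finset.sum_mul]
  exact Finset.sum_comm.trans
    (Finset.sum_congr rfl fun _ _ => Finset.sum_congr rfl fun _ _ => by ring)

/-- Actions on different legs commute (legs 1, 2). [folklore] -/
theorem lift₁_lift₂ [Fintype ι] [Fintype κ] (P : Matrix ι' ι R) (Q : Matrix κ' κ R)
    (t : ι → κ → μ → R) : lift₁ P (lift₂ Q t) = lift₂ Q (lift₁ P t) := by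
  funext a b c
  simp only [lift₁, lift₂, Finset.mul_sum]
  exact Finset.sum_comm.trans
    (Finset.sum_congr rfl fun _ _ => Finset.sum_congr rfl fun _ _ => by ring)

/-- Actions on different legs commute (legs 1, 3). [folklore] -/
theorem lift₁_lift₃ [Fintype ι] [Fintype μ] (P : Matrix ι' ι R) (Z : Matrix μ' μ R)
    (t : ι → κ → μ → R) : lift₁ P (lift₃ Z t) = lift₃ Z (lift₁ P t) := by
  funext a b c
  simp only [lift₁, lift₃, Finset.mul_sum]
  exact Finset.sum_comm.trans
    (Finset.sum_congr rfl fun _ _ => Finset.sum_congr rfl fun _ _ => by ring)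

/-- Actions on different legs commute (legs 2, 3). [folklore] -/
theorem lift₂_lift₃ [Fintype κ] [Fintype μ] (Q : Matrix κ' κ R) (Z : Matrix μ' μ R)
    (t : ι → κ → μ → R) : lift₂ Q (lift₃ Z t) = lift₃ Z (lift₂ Q t) := by
  funext a b c
  simp only [lift₂, lift₃, Finset.mul_sum]
  exact Finset.sum_comm.trans
    (Finset.sum_congr rfl fun _ _ => Finset.sum_congr rfl fun _ _ => by ring)

/-- The zero matrix acts by zero (leg 1). [folklore] -/
theorem lift₁_zero [Fintype ι] (t : ι → κ → μ → R) : lift₁ (0 : Matrix ι' ι R) t = 0 := by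
  funext a b c
  simp [lift₁]

/-- The zero matrix acts by zero (leg 2). [folklore] -/
theorem lift₂_zero [Fintype κ] (t : ι → κ → μ → R) : lift₂ (0 : Matrix κ' κ R) t = 0 := by
  funext a b c
  simp [lift₂]

/-- The zero matrix acts by zero (leg 3). [folklore] -/
theorem lift₃_zero [Fintype μ] (t : ι → κ → μ → R) : lift₃ (0 : Matrix μ' μ R) t = 0 := by
  funext a b c
  simp [lift₃]

/-- Additivity in the matrix (leg 1). [folklore] -/
theorem lift₁_add [Fintype ι] (P P' : Matrix ι' ι R) (t : ι → κ → μ → R) :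
    lift₁ (P + P') t = lift₁ P t + lift₁ P' t := by
  funext a b c
  simp [lift₁, add_mul, Finset.sum_add_distrib]

/-- Additivity in the matrix (leg 2). [folklore] -/
theorem lift₂_add [Fintype κ] (Q Q' : Matrix κ' κ R) (t : ι → κ → μ → R) :
    lift₂ (Q + Q') t = lift₂ Q t + lift₂ Q' t := by
  funext a b c
  simp [lift₂, add_mul, Finset.sum_add_distrib]

/-- Additivity in the matrix (leg 3). [folklore] -/
theorem lift₃_add [Fintype μ] (Z Z' : Matrix μ' μ R) (t : ι → κ → μ → R) :
    lift₃ (Z + Z') t = lift₃ Z t + lift₃ Z' t := by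
  funext a b c
  simp [lift₃, add_mul, Finset.sum_add_distrib]

/-- Homogeneity in the matrix (leg 1). [folklore] -/
theorem lift₁_smul [Fintype ι] (r : R) (P : Matrix ι' ι R) (t : ι → κ → μ → R) :
    lift₁ (r • P) t = r • lift₁ P t := by
  funext a b c
  simp [lift₁, Finset.mul_sum, mul_assoc]

/-- Homogeneity in the matrix (leg 2). [folklore] -/
theorem lift₂_smul [Fintype κ] (r : R) (Q : Matrix κ' κ R) (t : ι → κ → μ → R) :
    lift₂ (r • Q) t = r • lift₂ Q t := by
  funext a b c
  simp [lift₂, Finset.mul_sum, mul_assoc]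

/-- Homogeneity in the matrix (leg 3). [folklore] -/
theorem lift₃_smul [Fintype μ] (r : R) (Z : Matrix μ' μ R) (t : ι → κ → μ → R) :
    lift₃ (r • Z) t = r • lift₃ Z t := by
  funext a b c
  simp [lift₃, Finset.mul_sum, mul_assoc]

/-- Homogeneity in the tensor (leg 1). [folklore] -/
theorem lift₁_smul_right [Fintype ι] (r : R) (P : Matrix ι' ι R) (t : ι → κ → μ → R) :
    lift₁ P (r • t) = r • lift₁ P t := by
  funext a b c
  simp [lift₁, Finset.mul_sum, mul_left_comm]

/-- Homogeneity in the tensor (leg 2). [folklore] -/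
theorem lift₂_smul_right [Fintype κ] (r : R) (Q : Matrix κ' κ R) (t : ι → κ → μ → R) :
    lift₂ Q (r • t) = r • lift₂ Q t := by
  funext a b c
  simp [lift₂, Finset.mul_sum, mul_left_comm]

/-- Homogeneity in the tensor (leg 3). [folklore] -/
theorem lift₃_smul_right [Fintype μ] (r : R) (Z : Matrix μ' μ R) (t : ι → κ → μ → R) :
    lift₃ Z (r • t) = r • lift₃ Z t := by
  funext a b c
  simp [lift₃, Finset.mul_sum, mul_left_comm]

/-- Ring homomorphisms commute with the leg action (leg 1). [folklore] -/
theorem map_lift₁ [Fintype ι] {S : Type*} [CommRing S] (φ : R →+* S) (P : Matrix ι' ι R)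
    (t : ι → κ → μ → R) :
    (fun a b c => φ (lift₁ P t a b c)) = lift₁ (P.map φ) (fun a b c => φ (t a b c)) := by
  funext a b c
  simp [lift₁, map_sum, map_mul]

/-- Ring homomorphisms commute with the leg action (leg 2). [folklore] -/
theorem map_lift₂ [Fintype κ] {S : Type*} [CommRing S] (φ : R →+* S) (Q : Matrix κ' κ R)
    (t : ι → κ → μ → R) :
    (fun a b c => φ (lift₂ Q t a b c)) = lift₂ (Q.map φ) (fun a b c => φ (t a b c)) := by
  funext a b c
  simp [lift₂, map_sum, map_mul]

/-- Ring homomorphisms commute with the leg action (leg 3). [folklore] -/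
theorem map_lift₃ [Fintype μ] {S : Type*} [CommRing S] (φ : R →+* S) (Z : Matrix μ' μ R)
    (t : ι → κ → μ → R) :
    (fun a b c => φ (lift₃ Z t a b c)) = lift₃ (Z.map φ) (fun a b c => φ (t a b c)) := by
  funext a b c
  simp [lift₃, map_sum, map_mul]

/-- Leg-1 action of a reindexed matrix on a reindexed tensor. [folklore] -/
theorem lift₁_submatrix [Fintype ι] [Fintype ι'] {κ₀ μ₀ : Type*} (e₁ : ι' ≃ ι) (e₂ : κ' → κ₀)
    (e₃ : μ' → μ₀) (X : Matrix ι ι R) (t : ι → κ₀ → μ₀ → R) :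
    lift₁ (X.submatrix e₁ e₁) (fun a b c => t (e₁ a) (e₂ b) (e₃ c)) =
      fun a b c => lift₁ X t (e₁ a) (e₂ b) (e₃ c) := by
  funext a b c
  simp only [lift₁, Matrix.submatrix_apply]
  exact Fintype.sum_equiv e₁ _ _ fun _ => rfl

/-- Leg-2 action of a reindexed matrix on a reindexed tensor. [folklore] -/
theorem lift₂_submatrix [Fintype κ] [Fintype κ'] {ι₀ μ₀ : Type*} (e₁ : ι' → ι₀) (e₂ : κ' ≃ κ)
    (e₃ : μ' → μ₀) (Y : Matrix κ κ R) (t : ι₀ → κ → μ₀ → R) :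
    lift₂ (Y.submatrix e₂ e₂) (fun a b c => t (e₁ a) (e₂ b) (e₃ c)) =
      fun a b c => lift₂ Y t (e₁ a) (e₂ b) (e₃ c) := by
  funext a b c
  simp only [lift₂, Matrix.submatrix_apply]
  exact Fintype.sum_equiv e₂ _ _ fun _ => rfl

/-- Leg-3 action of a reindexed matrix on a reindexed tensor. [folklore] -/
theorem lift₃_submatrix [Fintype μ] [Fintype μ'] {ι₀ κ₀ : Type*} (e₁ : ι' → ι₀) (e₂ : κ' → κ₀)
    (e₃ : μ' ≃ μ) (Z : Matrix μ μ R) (t : ι₀ → κ₀ → μ → R) :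
    lift₃ (Z.submatrix e₃ e₃) (fun a b c => t (e₁ a) (e₂ b) (e₃ c)) =
      fun a b c => lift₃ Z t (e₁ a) (e₂ b) (e₃ c) := by
  funext a b c
  simp only [lift₃, Matrix.submatrix_apply]
  exact Fintype.sum_equiv e₃ _ _ fun _ => rfl

/-! ## The central submodule -/

/-- The **central submodule** of `t`: triples `(X, Y, Z)` of square matrices on the three legs
with `X ·₁ t = Z ·₃ t` and `Y ·₂ t = Z ·₃ t`. For the structure tensor of a unital algebra
these are the triples `(L_u, L_u, L_u)`, `u` central. [folklore] -/
def central [Fintype ι] [Fintype κ] [Fintype μ] (t : ι → κ → μ → R) :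
    Submodule R (Matrix ι ι R × Matrix κ κ R × Matrix μ μ R) where
  carrier := {w | lift₁ w.1 t = lift₃ w.2.2 t ∧ lift₂ w.2.1 t = lift₃ w.2.2 t}
  add_mem' {v w} hv hw := by
    obtain ⟨h1, h2⟩ := hv
    obtain ⟨h1', h2'⟩ := hw
    refine ⟨?_, ?_⟩
    · simp only [Prod.fst_add, Prod.snd_add, lift₁_add, lift₃_add, h1, h1']
    · simp only [Prod.fst_add, Prod.snd_add, lift₂_add, lift₃_add, h2, h2']
  zero_mem' := by
    refine ⟨?_, ?_⟩
    · simp only [Prod.fst_zero, Prod.snd_zero, lift₁_zero, lift₃_zero]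
    · simp only [Prod.fst_zero, Prod.snd_zero, lift₂_zero, lift₃_zero]
  smul_mem' r w hw := by
    obtain ⟨h1, h2⟩ := hw
    refine ⟨?_, ?_⟩
    · simp only [Prod.smul_fst, Prod.smul_snd, lift₁_smul, lift₃_smul, h1]
    · simp only [Prod.smul_fst, Prod.smul_snd, lift₂_smul, lift₃_smul, h2]

/-- Membership in the central submodule, unfolded. [folklore] -/
theorem mem_central_iff [Fintype ι] [Fintype κ] [Fintype μ] {t : ι → κ → μ → R}
    {X : Matrix ι ι R} {Y : Matrix κ κ R} {Z : Matrix μ μ R} :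
    (X, Y, Z) ∈ central t ↔ lift₁ X t = lift₃ Z t ∧ lift₂ Y t = lift₃ Z t := Iff.rfl

/-- Linear combinations of central triples are central (componentwise form). [folklore] -/
theorem central_lincomb [Fintype ι] [Fintype κ] [Fintype μ] {t : ι → κ → μ → R}
    {X₁ X₂ : Matrix ι ι R} {Y₁ Y₂ : Matrix κ κ R} {Z₁ Z₂ : Matrix μ μ R}
    (h₁ : (X₁, Y₁, Z₁) ∈ central t) (h₂ : (X₂, Y₂, Z₂) ∈ central t) (f g : R) :
    (f • X₁ + g • X₂, f • Y₁ + g • Y₂, f • Z₁ + g • Z₂) ∈ central t := by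
  simpa only [Prod.smul_mk, Prod.mk_add_mk] using
    (central t).add_mem ((central t).smul_mem f h₁) ((central t).smul_mem g h₂)

/-- The central submodule of `r • t`, `r` a non-zero scalar in a domain, is that of `t`.
[folklore] -/
theorem mem_central_smul_iff [Fintype ι] [Fintype κ] [Fintype μ] [IsDomain R]
    {t : ι → κ → μ → R} {r : R} (hr : r ≠ 0) {X : Matrix ι ι R} {Y : Matrix κ κ R}
    {Z : Matrix μ μ R} : (X, Y, Z) ∈ central (r • t) ↔ (X, Y, Z) ∈ central t := by
  simp only [mem_central_iff, lift₁_smul_right, lift₂_smul_right, lift₃_smul_right]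
  exact and_congr (smul_right_injective _ hr).eq_iff (smul_right_injective _ hr).eq_iff

/-- Central triples are transported along ring homomorphisms applied entrywise. [folklore] -/
theorem central_map [Fintype ι] [Fintype κ] [Fintype μ] {S : Type*} [CommRing S]
    (φ : R →+* S) {t : ι → κ → μ → R} {X : Matrix ι ι R} {Y : Matrix κ κ R}
    {Z : Matrix μ μ R} (h : (X, Y, Z) ∈ central t) :
    (X.map φ, Y.map φ, Z.map φ) ∈ central (fun a b c => φ (t a b c)) := by
  obtain ⟨h1, h2⟩ := h
  refine ⟨?_, ?_⟩
  · show lift₁ (X.map φ) _ = lift₃ (Z.map φ) _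
    rw [← map_lift₁, ← map_lift₃, h1]
  · show lift₂ (Y.map φ) _ = lift₃ (Z.map φ) _
    rw [← map_lift₂, ← map_lift₃, h2]

/-- Central triples are transported along reindexing by bijections. [folklore] -/
theorem central_reindex [Fintype ι] [Fintype κ] [Fintype μ] [Fintype ι'] [Fintype κ']
    [Fintype μ'] (e₁ : ι' ≃ ι) (e₂ : κ' ≃ κ) (e₃ : μ' ≃ μ) {t : ι → κ → μ → R}
    {X : Matrix ι ι R} {Y : Matrix κ κ R} {Z : Matrix μ μ R} (h : (X, Y, Z) ∈ central t) :
    (X.submatrix e₁ e₁, Y.submatrix e₂ e₂, Z.submatrix e₃ e₃) ∈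
      central (fun a b c => t (e₁ a) (e₂ b) (e₃ c)) := by
  obtain ⟨h1, h2⟩ := h
  refine ⟨?_, ?_⟩
  · show lift₁ (X.submatrix e₁ e₁) _ = lift₃ (Z.submatrix e₃ e₃) _
    rw [lift₁_submatrix, lift₃_submatrix]
    exact funext fun a => funext fun b => funext fun c => by rw [h1]
  · show lift₂ (Y.submatrix e₂ e₂) _ = lift₃ (Z.submatrix e₃ e₃) _
    rw [lift₂_submatrix, lift₃_submatrix]
    exact funext fun a => funext fun b => funext fun c => by rw [h2]

end Central

end Summit.MatrixMultiplication.MatrixMultiplication.Theorems
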